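import Summits.BirchSwinnertonDyer.BirchSwinnertonDyer.Theorems.SylvesterTwoHeegnerIndexCoupledTelescopeDerivList
import HarnessLib

/-!
# The COUPLED Cassels–Tate telescope, XXXIII: the FINITE-LEVEL invariance of `D_n y_n` modulo `2^M` under the
# group generated by the `σ_q` (Gross's Prop. 3.6 for `j = 0`, assembled; RESIDUE c v3 (T-L1), recipe input (R5))

Crux `UpperOffV0HSYPlus` (stmt-BirchSwinnertonDyer-19804).  With (T12) (`…CoupledTelescopeDerivList`: the per-
generator identity `σ_q (D_l y) − D_l y = (q+1) • D_{l ∖ q} y` and the passage from generators to the generated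
subgroup) this file states Gross's Prop. 3.6 at a finite level in the form the tree's descent lemma
`exists_fixedPoints_zsmul_eq_of_finite_level` (`GeomPointsEmbeddingDescent`) consumes as `hfin`: for a
pairwise-commuting list `l` of `(σ_q, q)` with `σ_q^{q+1} = 1`, `2^M ∣ q + 1` and `Σ_{i ≤ q} σ_q^i y = 0`
(all `a_q = 0`), EVERY `σ` in the subgroup generated by the `σ_q` satisfies
`∃ z, 2^M • z = σ (D_l y) − D_l y` in `W(L)`.  Combined with (T13) (`Gal(K[9pn₀]/K[9p]) ≤ ⨆ G_q`) and generators
of the `G_q` this is the recipe's (R5) `hP` for the class term at every square-free `n₀`.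
* ★ `exists_zsmul_eq_pointGalHom_foldr_derivOp_sub`.
Theorems only (no definition / named fact / instance / notation; the `Aut(L/ℚ)`-action on `W(L)` through
`pointGalHom` is a proof-local `letI`, as in `pointGalHom_derivOp_sub_eq_of_trace_eq_zero`); nothing asserted on
19804; no stub closed; X12.CMAtTwo NOT proved; BSD not claimed for any curve.  Sources: [GrossLMS1991] §3 Prop. 3.6;
[McCallumLMS1991] §4 (4).  `lean search 'exists_zsmul_eq_pointGalHom'` → nothing before this file.
-/

set_option linter.dupNamespace false -- Summits modules are `Summit.<Summit>.<Problem>…` by design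
set_option autoImplicit false

noncomputable section

open scoped Classical

namespace Summit.BirchSwinnertonDyer.BirchSwinnertonDyer.Theorems.SylvesterTwoCMFlip

open WeierstrassCurve Finset
open Literature.NumberTheory.EllipticCurves

variable (W : WeierstrassCurve ℚ) {L : Type} [Field L] [CharZero L] [DecidableEq L]

/-- ★ **Gross's Prop. 3.6 for `j = 0` at a finite level, assembled**: for a pairwise-commuting list `l` of
`(σ_q, q)` with `σ_q^{q+1} = 1`, `2^M ∣ q + 1`, `Σ_{i ≤ q} σ_q^i y = 0`, every `σ` in the subgroup generated by
the `σ_q` moves `D_l y` into `2^M · W(L)`: `∃ z, 2^M • z = σ (D_l y) − D_l y` (the `hfin` input of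
`exists_fixedPoints_zsmul_eq_of_finite_level`). [cite: GrossLMS1991, Prop. 3.6] [cite: McCallumLMS1991, §4 (4)] -/
theorem exists_zsmul_eq_pointGalHom_foldr_derivOp_sub (l : List ((L ≃ₐ[ℚ] L) × ℕ))
    (hc : ∀ a ∈ l, ∀ b ∈ l, Commute a.1 b.1) (hord : ∀ a ∈ l, a.1 ^ (a.2 + 1) = 1) {M : ℕ}
    (hdvd : ∀ a ∈ l, 2 ^ M ∣ a.2 + 1) {y : (W.baseChange L).toAffine.Point}
    (htr : ∀ a ∈ l, ∑ i ∈ Finset.range (a.2 + 1), pointGalHom W L (a.1 ^ i) y = 0)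
    {σ : L ≃ₐ[ℚ] L} (hσ : σ ∈ Subgroup.closure {g | ∃ a ∈ l, a.1 = g}) :
    ∃ z : (W.baseChange L).toAffine.Point,
      ((2 ^ M : ℕ) : ℤ) • z = pointGalHom W L σ (l.foldr (fun b z ↦ KolyvaginOperator.derivOp (pointGalHom W L) b.1 b.2 z) y) -
        l.foldr (fun b z ↦ KolyvaginOperator.derivOp (pointGalHom W L) b.1 b.2 z) y := by
  -- `Aut(L/ℚ)` acting on `W(L)` through `pointGalHom` (proof-local)
  letI act : DistribMulAction (L ≃ₐ[ℚ] L) ((W.baseChange L).toAffine.Point) :=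
    DistribMulAction.compHom _ (pointGalHom W L)
  have hsmul : ∀ (g : L ≃ₐ[ℚ] L) (Q : (W.baseChange L).toAffine.Point), g • Q = pointGalHom W L g Q :=
    fun _ _ ↦ rfl
  have key := exists_smul_eq_smul_sub_of_mem_closure (G := L ≃ₐ[ℚ] L)
    (⊤ : AddSubgroup ((W.baseChange L).toAffine.Point)) (fun _ _ _ ↦ AddSubgroup.mem_top _)
    (((2 ^ M : ℕ) : ℤ))
    (x := l.foldr (fun b z ↦ KolyvaginOperator.derivOp (pointGalHom W L) b.1 b.2 z) y)
    (S := {g | ∃ a ∈ l, a.1 = g}) (fun s hs ↦ ?_) hσ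
  · obtain ⟨z, -, hz⟩ := key
    exact ⟨z, by rw [hz, hsmul]⟩
  · obtain ⟨a, ha, rfl⟩ := hs
    obtain ⟨r, hr⟩ := hdvd a ha
    refine ⟨(r : ℤ) • (l.erase a).foldr (fun b z ↦ KolyvaginOperator.derivOp (pointGalHom W L) b.1 b.2 z) y,
      AddSubgroup.mem_top _, ?_⟩
    rw [hsmul, pointGalHom_foldr_derivOp_sub_eq_of_mem W hc ha (hord a ha) (htr a ha), smul_smul, hr]
    push_cast
    ring_nf

end Summit.BirchSwinnertonDyer.BirchSwinnertonDyer.Theorems.SylvesterTwoCMFlip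

end
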